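import Summits.Ventures.LatticeQCDFlow.TrivializingMaps.WilsonVarianceFloorAllCouplings
import Summits.Ventures.LatticeQCDFlow.TrivializingMaps.WilsonPinching

/-!
HONEST FRAMING: exact (Metropolis-corrected) sampling algorithms for lattice gauge theory; figures
of merit are autocorrelation/cost numbers at stated couplings and volumes; no continuum-physics
claim.

# AnnealingSufficiencyAnyGroup — UNIFORM ANNEALING BY EXACT REWEIGHTING HAS TOTAL LOG WEIGHT SECOND
# MOMENT AT MOST `δ·(⟨S_W⟩_a − ⟨S_W⟩_{b+δ}) ≤ 2N·#plaq·(b − a)/k`: `Θ(volume)` LAYERS ARE NECESSARY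
# AND SUFFICIENT, EVERY COMPACT GAUGE GROUP, EVERY COUPLING WINDOW (lean-2 GEN-10, ours)

Venture-side (OURS).  Cell `lqcd-flow` (pub-lqcd), unit `pub-lqcd-lean-2-g10`, 2026-08-23.  The
SUFFICIENCY companion of the necessity laws `AnnealingAnyGroup.wilson_schedule_cost_ge_anyGroup`
(GEN-8, strong coupling) and `WilsonVarianceFloorAllCouplings.wilson_schedule_cost_ge_allCouplings`
(GEN-9, every coupling).  Setting of `ReweightingStepLawAnyGroup`: `G` any compact second-countable
Hausdorff-Borel group, `ρ : G →* Matrix (Fin N) (Fin N) ℂ` any continuous representation,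
`S = S_W^ρ = Σ_p (N − Re tr ρ(U_p))` Wave 0's Wilson action on the torus `(ℤ/L)^d`,
`μ_t = wilsonMeasure ρ t`, `ψ = cgf(−S_W^ρ)` under `D[U]` (so `E_{μ_β}[(dμ_{β+δ}/dμ_β)²] =
exp(ψ(β+2δ) − 2ψ(β+δ) + ψ(β))`, `weight_sq_integral_eq_anyGroup`).

* §1 (dictionary, every real `t`): `ψ′(t) = −⟨S_W⟩_{μ_t}` (`deriv_cgf_eq_neg_mean`, Mathlib's
  `integral_tilted_mul_self`); the FLUCTUATION RELATION for every compact gauge group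
  `⟨S_W⟩_a − ⟨S_W⟩_b = ∫_a^b Var_u(S_W) du` (`mean_sub_mean_eq_integral_variance`; the `SU(n)`
  ambient version is `StaircaseMeanActionLaw`); `t ↦ ⟨S_W⟩_t` is antitone and takes values in
  `[0, 2N·#plaq]` (`mean_wilsonAction_antitone`, `mean_wilsonAction_nonneg/_le`).
* §2 (one step, `δ ≥ 0`): `ψ(c+δ) − ψ(c) ∈ [δψ′(c), δψ′(c+δ)]` (convexity), hence
  **`ψ(β+2δ) − 2ψ(β+δ) + ψ(β) ≤ δ·(⟨S_W⟩_β − ⟨S_W⟩_{β+2δ}) ≤ 2N·#plaq·δ`**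
  (`cgf_second_difference_le_mul_mean_drop`, `cgf_second_difference_le_volume`).
* §3 (the uniform `k`-step schedule `β_j = a + jδ`): the summed log second moment TELESCOPES,
  `Σ_{j<k} Δ²ψ(β_j; δ) = [ψ(a+(k+1)δ) − ψ(a+kδ)] − [ψ(a+δ) − ψ(a)]` (`sum_second_difference_uniform`),
  and is SANDWICHED by mean-action drops,
  **`δ·(⟨S⟩_{a+δ} − ⟨S⟩_{a+kδ}) ≤ Σ_{j<k} Δ²ψ(β_j; δ) ≤ δ·(⟨S⟩_a − ⟨S⟩_{a+(k+1)δ}) ≤ 2N·#plaq·δ`**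
  (`uniform_schedule_cost_ge_mean_drop`, `…_le_mean_drop`, `…_le_volume`).  READING (`δ = (b−a)/k`):
  uniform annealing from `a` to `b` by `k` exact reweighting steps has `Σ_j log E[w_j²] ≤
  2N·#plaq·(b−a)/k`, so **`k ≥ 2N·#plaq·(b − a)/t` layers SUFFICE for `Σ_j log E[w_j²] ≤ t`**
  (`uniform_steps_sufficient`) — for EVERY compact `G`, every continuous `ρ`, every real `a ≤ b`,
  every `d`, `L`, with no variance ceiling and no expansion.
* §4 (two-sided volume law, unitary `ρ`, `d ≥ 2`, `L ≥ 2`, window `[a, a+(k+1)δ] ⊆ [−M, M]`):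
  **`e^{−cM}·⌊L/2⌋^d·Var_Haar(Re tr ρ)·kδ² ≤ Σ_{j<k} Δ²ψ(β_j; δ) ≤ 2N·#plaq·δ`**, `c = 2NK(1+4K)`,
  `K = (d+1)d²` (`uniform_schedule_cost_two_sided`): at fixed total log second moment `t` and fixed
  window, the number of uniform exact reweighting / annealing layers is bounded below AND above by
  constants times the VOLUME over `t` (`#plaq ≤ d²L^d ≤ d²3^d⌊L/2⌋^d`).

Precedents (credited, not imported): the abstract telescoping / sandwich for a convex free energy is
theory2's HOME-tier item 124 §2 (`unifCost_eq`, `unifCost_le_drop`, 2026-08-22) and, for finite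
exponential families with perfect relaxation, the tree's `Scaling/AnnealingCostSandwich`
(`negLog_prod_essFrac_unif_sandwich`); this file is the measure-level statement for lattice gauge
theory with an arbitrary compact gauge group, docked to the tree's necessity laws.
NOT CLAIMED: a per-step window of order `1/√volume` (that needs a variance CEILING; the per-step
bound here is `2N·#plaq·δ`); finite-sample ESS / acceptance statements; anything about flows,
autocorrelations or the continuum.  Literature grade (cell rule): elementary (convexity of `log Z`);
new typing.
-/

noncomputable section

open MeasureTheory ProbabilityTheory Set intervalIntegral
open Literature.MathematicalPhysics.QuantumFieldTheory
open Literature.MathematicalPhysics.QuantumFieldTheory.Luscher2010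
open scoped Matrix Matrix.Norms.Frobenius ContDiff

namespace Summit.Ventures.LatticeQCDFlow.TrivializingMaps

section AnyGroup

variable {d L N : ℕ} [NeZero L] {G : Type*} [Group G] [TopologicalSpace G] [IsTopologicalGroup G]
  [CompactSpace G] [MeasurableSpace G] [BorelSpace G] [SecondCountableTopology G]
  (ρ : G →* Matrix (Fin N) (Fin N) ℂ)

/-! ## §1 Dictionary: `ψ′ = −⟨S_W⟩`, the fluctuation relation, monotonicity and range of the mean action -/

/-- **`ψ′(t) = −⟨S_W^ρ⟩_{μ_t}`** (`ψ = cgf(−S_W^ρ)` under `D[U]`, `μ_t = wilsonMeasure ρ t`). [folklore] -/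
theorem deriv_cgf_eq_neg_mean (hρ : Continuous ρ) (t : ℝ) :
    deriv (cgf (fun U => -wilsonAction ρ U) (trivialMeasure G d L)) t =
      -∫ U, wilsonAction ρ U ∂(wilsonMeasure (d := d) (L := L) ρ t) := by
  rw [← integral_tilted_mul_self (mem_interior_integrableExpSet_neg_wilsonAction ρ hρ t),
    ← wilsonMeasure_eq_tilted_neg ρ hρ t, MeasureTheory.integral_neg]

/-- The Wilson action is integrable under every `μ_t` (bounded continuous, probability measure).
[folklore] -/
theorem integrable_wilsonAction_wilsonMeasure (hρ : Continuous ρ) (t : ℝ) :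
    Integrable (wilsonAction ρ) (wilsonMeasure (d := d) (L := L) ρ t) := by
  haveI := isProbabilityMeasure_wilsonMeasure (d := d) (L := L) ρ hρ t
  exact (BoundedContinuousFunction.mkOfCompact ⟨wilsonAction ρ,
    continuous_wilsonAction_of_continuous ρ hρ⟩).integrable _

omit [SecondCountableTopology G] in
/-- `0 ≤ ⟨S_W^ρ⟩_{μ_t}`. [folklore] -/
theorem mean_wilsonAction_nonneg (hρ : Continuous ρ) (t : ℝ) :
    0 ≤ ∫ U, wilsonAction ρ U ∂(wilsonMeasure (d := d) (L := L) ρ t) :=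
  integral_nonneg fun U => WilsonPinching.wilsonAction_nonneg ρ hρ U

/-- `⟨S_W^ρ⟩_{μ_t} ≤ 2N·#plaq`. [folklore] -/
theorem mean_wilsonAction_le (hρ : Continuous ρ) (t : ℝ) :
    ∫ U, wilsonAction ρ U ∂(wilsonMeasure (d := d) (L := L) ρ t) ≤
      2 * N * Fintype.card (Plaquette d L) := by
  haveI := isProbabilityMeasure_wilsonMeasure (d := d) (L := L) ρ hρ t
  calc ∫ U, wilsonAction ρ U ∂(wilsonMeasure (d := d) (L := L) ρ t)
      ≤ ∫ _U, (2 * N * Fintype.card (Plaquette d L) : ℝ) ∂(wilsonMeasure (d := d) (L := L) ρ t) :=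
        MeasureTheory.integral_mono (integrable_wilsonAction_wilsonMeasure ρ hρ t)
          (MeasureTheory.integrable_const _) fun U => WilsonPinching.wilsonAction_le ρ hρ U
    _ = 2 * N * Fintype.card (Plaquette d L) := by
        rw [MeasureTheory.integral_const, smul_eq_mul, probReal_univ, one_mul]

/-- `ψ′(b) − ψ′(a) = ∫_a^b Var_u(S_W^ρ) du`. [folklore] -/
theorem deriv_cgf_sub_eq_integral_variance (hρ : Continuous ρ) (a b : ℝ) :
    deriv (cgf (fun U => -wilsonAction ρ U) (trivialMeasure G d L)) b -
        deriv (cgf (fun U => -wilsonAction ρ U) (trivialMeasure G d L)) a =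
      ∫ u in a..b, variance (wilsonAction (d := d) (L := L) ρ)
        (wilsonMeasure (d := d) (L := L) ρ u) :=
  (integral_eq_sub_of_hasDerivAt (fun t _ => hasDerivAt_deriv_cgf_anyGroup (d := d) (L := L) hρ t)
    ((continuous_variance_wilsonMeasure hρ).intervalIntegrable a b)).symm

/-- **FLUCTUATION RELATION, every compact gauge group**: `⟨S_W⟩_a − ⟨S_W⟩_b = ∫_a^b Var_u(S_W) du`.
[folklore] -/
theorem mean_sub_mean_eq_integral_variance (hρ : Continuous ρ) (a b : ℝ) :
    (∫ U, wilsonAction ρ U ∂(wilsonMeasure (d := d) (L := L) ρ a)) -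
        ∫ U, wilsonAction ρ U ∂(wilsonMeasure (d := d) (L := L) ρ b) =
      ∫ u in a..b, variance (wilsonAction (d := d) (L := L) ρ)
        (wilsonMeasure (d := d) (L := L) ρ u) := by
  rw [← deriv_cgf_sub_eq_integral_variance ρ hρ a b, deriv_cgf_eq_neg_mean ρ hρ,
    deriv_cgf_eq_neg_mean ρ hρ]
  ring

/-- `ψ′` is monotone (`ψ″ = Var ≥ 0`). [folklore] -/
theorem deriv_cgf_monotone (hρ : Continuous ρ) :
    Monotone (deriv (cgf (fun U => -wilsonAction ρ U) (trivialMeasure G d L))) := by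
  intro a b hab
  have h := deriv_cgf_sub_eq_integral_variance (d := d) (L := L) ρ hρ a b
  have hnn : 0 ≤ ∫ u in a..b, variance (wilsonAction (d := d) (L := L) ρ)
      (wilsonMeasure (d := d) (L := L) ρ u) :=
    intervalIntegral.integral_nonneg hab fun u _ => variance_nonneg _ _
  linarith

/-- **The mean action `t ↦ ⟨S_W⟩_{μ_t}` is antitone**, every compact gauge group. [folklore] -/
theorem mean_wilsonAction_antitone (hρ : Continuous ρ) :
    Antitone fun t : ℝ => ∫ U, wilsonAction ρ U ∂(wilsonMeasure (d := d) (L := L) ρ t) := by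
  intro a b hab
  have h := deriv_cgf_monotone (d := d) (L := L) ρ hρ hab
  rw [deriv_cgf_eq_neg_mean ρ hρ, deriv_cgf_eq_neg_mean ρ hρ] at h
  simpa using h

/-! ## §2 One exact reweighting step: `Δ²ψ(β; δ) ≤ δ·(⟨S⟩_β − ⟨S⟩_{β+2δ}) ≤ 2N·#plaq·δ` -/

/-- Convexity, upper chord: `ψ(c+δ) − ψ(c) ≤ δ·ψ′(c+δ)` for `δ ≥ 0`. [folklore] -/
theorem cgf_sub_le_mul_deriv (hρ : Continuous ρ) {δ : ℝ} (hδ : 0 ≤ δ) (c : ℝ) :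
    cgf (fun U => -wilsonAction ρ U) (trivialMeasure G d L) (c + δ) -
        cgf (fun U => -wilsonAction ρ U) (trivialMeasure G d L) c ≤
      δ * deriv (cgf (fun U => -wilsonAction ρ U) (trivialMeasure G d L)) (c + δ) := by
  set ψ := cgf (fun U => -wilsonAction ρ U) (trivialMeasure G d L) with hψ
  have hψ'c : Continuous (deriv ψ) := continuous_iff_continuousAt.2 fun t =>
    (hasDerivAt_deriv_cgf_anyGroup (d := d) (L := L) hρ t).continuousAt
  have h1 : ψ (c + δ) - ψ c = ∫ t in c..c + δ, deriv ψ t :=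
    (integral_eq_sub_of_hasDerivAt (fun t _ => hasDerivAt_cgf_anyGroup (d := d) (L := L) hρ t)
      (hψ'c.intervalIntegrable _ _)).symm
  have h2 : ∫ _ in c..c + δ, deriv ψ (c + δ) = δ * deriv ψ (c + δ) := by
    rw [intervalIntegral.integral_const, smul_eq_mul]; ring
  rw [h1, ← h2]
  exact intervalIntegral.integral_mono_on (by linarith) (hψ'c.intervalIntegrable _ _)
    (continuous_const.intervalIntegrable _ _)
    fun t ht => deriv_cgf_monotone (d := d) (L := L) ρ hρ ht.2

/-- Convexity, lower chord: `δ·ψ′(c) ≤ ψ(c+δ) − ψ(c)` for `δ ≥ 0`. [folklore] -/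
theorem mul_deriv_le_cgf_sub (hρ : Continuous ρ) {δ : ℝ} (hδ : 0 ≤ δ) (c : ℝ) :
    δ * deriv (cgf (fun U => -wilsonAction ρ U) (trivialMeasure G d L)) c ≤
      cgf (fun U => -wilsonAction ρ U) (trivialMeasure G d L) (c + δ) -
        cgf (fun U => -wilsonAction ρ U) (trivialMeasure G d L) c := by
  set ψ := cgf (fun U => -wilsonAction ρ U) (trivialMeasure G d L) with hψ
  have hψ'c : Continuous (deriv ψ) := continuous_iff_continuousAt.2 fun t =>
    (hasDerivAt_deriv_cgf_anyGroup (d := d) (L := L) hρ t).continuousAt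
  have h1 : ψ (c + δ) - ψ c = ∫ t in c..c + δ, deriv ψ t :=
    (integral_eq_sub_of_hasDerivAt (fun t _ => hasDerivAt_cgf_anyGroup (d := d) (L := L) hρ t)
      (hψ'c.intervalIntegrable _ _)).symm
  have h2 : ∫ _ in c..c + δ, deriv ψ c = δ * deriv ψ c := by
    rw [intervalIntegral.integral_const, smul_eq_mul]; ring
  rw [h1, ← h2]
  exact intervalIntegral.integral_mono_on (by linarith) (continuous_const.intervalIntegrable _ _)
    (hψ'c.intervalIntegrable _ _)
    fun t ht => deriv_cgf_monotone (d := d) (L := L) ρ hρ ht.1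

/-- **ONE STEP: `ψ(β+2δ) − 2ψ(β+δ) + ψ(β) ≤ δ·(⟨S_W⟩_β − ⟨S_W⟩_{β+2δ})`** (`δ ≥ 0`), every compact
gauge group, every coupling, every volume: the log second moment of the weight of one exact
reweighting step is at most the step times the drop of the mean action over the doubled step. [ours] -/
theorem cgf_second_difference_le_mul_mean_drop (hρ : Continuous ρ) {β δ : ℝ} (hδ : 0 ≤ δ) :
    cgf (fun U => -wilsonAction ρ U) (trivialMeasure G d L) (β + 2 * δ) -
        2 * cgf (fun U => -wilsonAction ρ U) (trivialMeasure G d L) (β + δ) +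
        cgf (fun U => -wilsonAction ρ U) (trivialMeasure G d L) β ≤
      δ * ((∫ U, wilsonAction ρ U ∂(wilsonMeasure (d := d) (L := L) ρ β)) -
        ∫ U, wilsonAction ρ U ∂(wilsonMeasure (d := d) (L := L) ρ (β + 2 * δ))) := by
  have h1 := cgf_sub_le_mul_deriv (d := d) (L := L) ρ hρ hδ (β + δ)
  have h2 := mul_deriv_le_cgf_sub (d := d) (L := L) ρ hρ hδ β
  rw [show β + δ + δ = β + 2 * δ by ring, deriv_cgf_eq_neg_mean ρ hρ] at h1
  rw [deriv_cgf_eq_neg_mean ρ hρ] at h2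
  linarith

/-- **ONE STEP, VOLUME FORM: `ψ(β+2δ) − 2ψ(β+δ) + ψ(β) ≤ 2N·#plaq·δ`** (`δ ≥ 0`). [ours] -/
theorem cgf_second_difference_le_volume (hρ : Continuous ρ) {β δ : ℝ} (hδ : 0 ≤ δ) :
    cgf (fun U => -wilsonAction ρ U) (trivialMeasure G d L) (β + 2 * δ) -
        2 * cgf (fun U => -wilsonAction ρ U) (trivialMeasure G d L) (β + δ) +
        cgf (fun U => -wilsonAction ρ U) (trivialMeasure G d L) β ≤
      2 * N * Fintype.card (Plaquette d L) * δ := by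
  have h := cgf_second_difference_le_mul_mean_drop (d := d) (L := L) ρ hρ (β := β) hδ
  have hA := mean_wilsonAction_le (d := d) (L := L) ρ hρ β
  have hB := mean_wilsonAction_nonneg (d := d) (L := L) ρ hρ (β + 2 * δ)
  nlinarith

/-! ## §3 The uniform `k`-step schedule `β_j = a + jδ`: telescoping, sandwich, volume bound -/

/-- **TELESCOPING**: for every `f : ℝ → ℝ`,
`Σ_{j<k} (f(a+jδ+2δ) − 2f(a+jδ+δ) + f(a+jδ)) = [f(a+(k+1)δ) − f(a+kδ)] − [f(a+δ) − f(a)]`. [folklore] -/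
theorem sum_second_difference_uniform (f : ℝ → ℝ) (a δ : ℝ) (k : ℕ) :
    ∑ j ∈ Finset.range k, (f (a + j * δ + 2 * δ) - 2 * f (a + j * δ + δ) + f (a + j * δ)) =
      (f (a + (k + 1) * δ) - f (a + k * δ)) - (f (a + δ) - f a) := by
  have h := Finset.sum_range_sub (fun j : ℕ => f (a + (j + 1) * δ) - f (a + j * δ)) k
  simp only [Nat.cast_add, Nat.cast_one, Nat.cast_zero, zero_add, zero_mul, add_zero,
    one_mul] at h
  rw [← h]
  refine Finset.sum_congr rfl fun j _ => ?_
  ring_nf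

/-- **SANDWICH, upper side: `Σ_{j<k} Δ²ψ(a+jδ; δ) ≤ δ·(⟨S_W⟩_a − ⟨S_W⟩_{a+(k+1)δ})`** (`δ ≥ 0`),
every compact gauge group. [ours] -/
theorem uniform_schedule_cost_le_mean_drop (hρ : Continuous ρ) (a : ℝ) {δ : ℝ} (hδ : 0 ≤ δ)
    (k : ℕ) :
    ∑ j ∈ Finset.range k,
        (cgf (fun U => -wilsonAction ρ U) (trivialMeasure G d L) (a + j * δ + 2 * δ) -
          2 * cgf (fun U => -wilsonAction ρ U) (trivialMeasure G d L) (a + j * δ + δ) +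
          cgf (fun U => -wilsonAction ρ U) (trivialMeasure G d L) (a + j * δ)) ≤
      δ * ((∫ U, wilsonAction ρ U ∂(wilsonMeasure (d := d) (L := L) ρ a)) -
        ∫ U, wilsonAction ρ U ∂(wilsonMeasure (d := d) (L := L) ρ (a + (k + 1) * δ))) := by
  rw [sum_second_difference_uniform]
  have h1 := cgf_sub_le_mul_deriv (d := d) (L := L) ρ hρ hδ (a + k * δ)
  have h2 := mul_deriv_le_cgf_sub (d := d) (L := L) ρ hρ hδ a
  rw [show a + k * δ + δ = a + (k + 1) * δ by ring, deriv_cgf_eq_neg_mean ρ hρ] at h1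
  rw [deriv_cgf_eq_neg_mean ρ hρ] at h2
  linarith

/-- **SANDWICH, lower side: `δ·(⟨S_W⟩_{a+δ} − ⟨S_W⟩_{a+kδ}) ≤ Σ_{j<k} Δ²ψ(a+jδ; δ)`** (`δ ≥ 0`),
every compact gauge group. [ours] -/
theorem uniform_schedule_cost_ge_mean_drop (hρ : Continuous ρ) (a : ℝ) {δ : ℝ} (hδ : 0 ≤ δ)
    (k : ℕ) :
    δ * ((∫ U, wilsonAction ρ U ∂(wilsonMeasure (d := d) (L := L) ρ (a + δ))) -
        ∫ U, wilsonAction ρ U ∂(wilsonMeasure (d := d) (L := L) ρ (a + k * δ))) ≤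
      ∑ j ∈ Finset.range k,
        (cgf (fun U => -wilsonAction ρ U) (trivialMeasure G d L) (a + j * δ + 2 * δ) -
          2 * cgf (fun U => -wilsonAction ρ U) (trivialMeasure G d L) (a + j * δ + δ) +
          cgf (fun U => -wilsonAction ρ U) (trivialMeasure G d L) (a + j * δ)) := by
  rw [sum_second_difference_uniform]
  have h1 := mul_deriv_le_cgf_sub (d := d) (L := L) ρ hρ hδ (a + k * δ)
  have h2 := cgf_sub_le_mul_deriv (d := d) (L := L) ρ hρ hδ a
  rw [show a + k * δ + δ = a + (k + 1) * δ by ring, deriv_cgf_eq_neg_mean ρ hρ] at h1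
  rw [deriv_cgf_eq_neg_mean ρ hρ] at h2
  linarith

/-- **VOLUME BOUND: `Σ_{j<k} Δ²ψ(a+jδ; δ) ≤ 2N·#plaq·δ`** (`δ ≥ 0`): uniform annealing from `a` to
`b = a + kδ` by `k` exact reweighting steps has summed log weight second moment at most
`2N·#plaq·(b − a)/k` — every compact gauge group, every continuous representation, every coupling
window, every volume. [ours] -/
theorem uniform_schedule_cost_le_volume (hρ : Continuous ρ) (a : ℝ) {δ : ℝ} (hδ : 0 ≤ δ) (k : ℕ) :
    ∑ j ∈ Finset.range k,
        (cgf (fun U => -wilsonAction ρ U) (trivialMeasure G d L) (a + j * δ + 2 * δ) -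
          2 * cgf (fun U => -wilsonAction ρ U) (trivialMeasure G d L) (a + j * δ + δ) +
          cgf (fun U => -wilsonAction ρ U) (trivialMeasure G d L) (a + j * δ)) ≤
      2 * N * Fintype.card (Plaquette d L) * δ := by
  have h := uniform_schedule_cost_le_mean_drop (d := d) (L := L) ρ hρ a hδ k
  have hA := mean_wilsonAction_le (d := d) (L := L) ρ hρ a
  have hB := mean_wilsonAction_nonneg (d := d) (L := L) ρ hρ (a + (k + 1) * δ)
  nlinarith

/-- **LAYERS SUFFICIENT — LINEAR IN THE VOLUME.**  For every `t > 0`, `a ≤ b` and `k ≥ 1` with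
`2N·#plaq·(b − a) ≤ t·k`, the uniform `k`-step schedule `β_j = a + j(b−a)/k` of exact reweighting
steps has `Σ_{j<k} log E_{μ_{β_j}}[w_j²] = Σ_{j<k} Δ²ψ(β_j; (b−a)/k) ≤ t`: `⌈2N·#plaq·(b−a)/t⌉` layers
suffice, for every compact gauge group, continuous representation, coupling window and volume. [ours] -/
theorem uniform_steps_sufficient (hρ : Continuous ρ) {a b t : ℝ} (hab : a ≤ b) {k : ℕ} (hk : 1 ≤ k)
    (hkt : 2 * N * Fintype.card (Plaquette d L) * (b - a) ≤ t * k) :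
    ∑ j ∈ Finset.range k,
        (cgf (fun U => -wilsonAction ρ U) (trivialMeasure G d L) (a + j * ((b - a) / k) + 2 * ((b - a) / k)) -
          2 * cgf (fun U => -wilsonAction ρ U) (trivialMeasure G d L) (a + j * ((b - a) / k) + (b - a) / k) +
          cgf (fun U => -wilsonAction ρ U) (trivialMeasure G d L) (a + j * ((b - a) / k))) ≤ t := by
  have hk0 : (0 : ℝ) < k := by exact_mod_cast hk
  have hδ : 0 ≤ (b - a) / k := div_nonneg (sub_nonneg.2 hab) hk0.le
  refine (uniform_schedule_cost_le_volume (d := d) (L := L) ρ hρ a hδ k).trans ?_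
  rw [← mul_div_assoc, div_le_iff₀ hk0]
  exact hkt

/-! ## §4 The two-sided volume law for uniform annealing (unitary `ρ`, `d ≥ 2`, `L ≥ 2`) -/

/-- **TWO-SIDED VOLUME LAW FOR UNIFORM ANNEALING, EVERY COMPACT GAUGE GROUP.**  For unitary continuous
`ρ`, `d ≥ 2`, `L ≥ 2`, `δ ≥ 0`, `k ≥ 1` and a window `[a, a+(k+1)δ] ⊆ [−M, M]`:
`e^{−cM}·⌊L/2⌋^d·Var_Haar(Re tr ρ)·(kδ)²/k ≤ Σ_{j<k} Δ²ψ(a+jδ; δ) ≤ 2N·#plaq·δ`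
(`c = 2NK(1+4K)`, `K = (d+1)d²`; lower side = GEN-9's `wilson_schedule_cost_ge_allCouplings`).
With `#plaq ≤ d²3^d⌊L/2⌋^d`: at fixed window and fixed total log second moment the number of uniform
exact reweighting layers is `Θ(volume)`. [ours] -/
theorem uniform_schedule_cost_two_sided (hd : 2 ≤ d) (hL : 2 ≤ L) (hρ : Continuous ρ)
    (hρu : ∀ g, ρ g ∈ Matrix.unitaryGroup (Fin N) ℂ) (a : ℝ) {δ M : ℝ} (hδ : 0 ≤ δ) {k : ℕ}
    (hk : 1 ≤ k) (hlo : -M ≤ a) (hhi : a + (k + 1) * δ ≤ M) :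
    Real.exp (-(M * (2 * N * ((d + 1) * d ^ 2 : ℕ) * (1 + 4 * ((d + 1) * d ^ 2 : ℕ))))) *
          ((L / 2) ^ d : ℕ) * variance (fun g => (ρ g).trace.re) (haarProbability G) *
          (k * δ) ^ 2 / k ≤
        ∑ j ∈ Finset.range k,
          (cgf (fun U => -wilsonAction ρ U) (trivialMeasure G d L) (a + j * δ + 2 * δ) -
            2 * cgf (fun U => -wilsonAction ρ U) (trivialMeasure G d L) (a + j * δ + δ) +
            cgf (fun U => -wilsonAction ρ U) (trivialMeasure G d L) (a + j * δ)) ∧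
      ∑ j ∈ Finset.range k,
          (cgf (fun U => -wilsonAction ρ U) (trivialMeasure G d L) (a + j * δ + 2 * δ) -
            2 * cgf (fun U => -wilsonAction ρ U) (trivialMeasure G d L) (a + j * δ + δ) +
            cgf (fun U => -wilsonAction ρ U) (trivialMeasure G d L) (a + j * δ)) ≤
        2 * N * Fintype.card (Plaquette d L) * δ := by
  refine ⟨?_, uniform_schedule_cost_le_volume (d := d) (L := L) ρ hρ a hδ k⟩
  have h := wilson_schedule_cost_ge_allCouplings (d := d) (L := L) ρ hd hL hρ hρu hk
    (fun i => a + i * δ) (fun _ => δ) (fun i => by push_cast; ring) (fun _ _ => hδ)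
    (D := δ) (M := M) (fun _ _ => le_rfl) (by simpa using hlo)
    (by have e : a + (k : ℝ) * δ + δ = a + (k + 1) * δ := by ring
        simpa [e] using hhi)
  simpa using h

end AnyGroup

end Summit.Ventures.LatticeQCDFlow.TrivializingMaps

end
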